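import Literature.MathematicalPhysics.QuantumLattice.HubbardNNNHoppingEnergyDensityTilingAnyParity
import Literature.MathematicalPhysics.QuantumLattice.HubbardFillingBoxChemicalPotentialCell
import Literature.MathematicalPhysics.QuantumLattice.HubbardNNNHoppingRemovalCost
import Literature.MathematicalPhysics.QuantumLattice.HubbardStateSectorDecomposition
import HarnessLib

/-!
# The grand-canonical floor of the `t–t'` Hubbard torus at a supporting slope, with an explicit rate

Topic `MathematicalPhysics/QuantumLattice`, family `hubbard`; namespace
`Literature.MathematicalPhysics.QuantumLattice.ThermodynamicLimit` (the file path). For `U ≥ 0`, a density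
`0 < n < 2` and a chemical potential `μ` in the subdifferential `[μ₋(n), μ₊(n)]` of the convex energy density
`e = energyDensityTT' t t' U` at `n` (equivalently: `n` minimises `x ↦ e(x) − μx` on `[0,2)`,
`mem_Icc_chemPot_iff_isMinOn`), the grand-canonical operator `K_L = H_L − μ N̂` on the FULL Fock space of
the torus `(ℤ/Lℤ)²` (`H_L = hubbardTorusTT' L t t' U`) is bounded below, uniformly in the state, by the
Legendre value `(e(n) − μn)·L²` up to an explicit boundary term `O(L)`:

* `sub_mul_sq_le_groundEnergy_sub_mul_of_lt` — sector form, `M < 2L²`: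
  `(e(n) − μn)L² − (16|t| + 32|t'|)L ≤ E_L(M) − μM` (the any-parity tiling bound
  `energyDensityTT'_le_torus_of_lt` — "the limit is an infimum" — composed with the ensemble dictionary
  `isMinOn_sub_mul_of_mem_Icc_chemPot`);
* `sub_mul_sq_le_groundEnergy_sub_mul` — every sector `M ≤ 2L²` (the filled band `M = 2L²` through the
  pair-removal cost `groundEnergy_hubbardTorusTT'_le_add_pairs`), with the constant
  `C₀ = 4·18(2|t| + |U| + 2|t'|) + 2|μ|`;
* `sub_mul_sq_le_re_expect_sub_mul_totalNumber` — **Fock form**: for EVERY unit vector `χ` of the Fock space,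
  `(e(n) − μn)L² − (16|t| + 32|t'|)L − C₀ ≤ Re⟨χ, (H_L − μN̂)χ⟩` (number-sector decomposition
  `sum_numberProj_mulVec`, `H_L` conserves `N̂`).

This is the "global `K_μ`-floor" input of the charged-stationarity (OP1-C) tier of the one-point pair-LRO
ceiling (hubbard-obs PAIRCORR-SDP §13.2; MENU3-TLPINCER §7.4 (i),(v),(vi), §7.8): against it the Koma–Tasaki
tower witness of a density-`n` ground-state family has excess `o(L²)` (Fenchel–Young equality at a
supporting slope), so finite-volume Pusz–Woronowicz makes the charged equation-of-motion rows
`ω([H − μN̂, X]) = 0` asymptotically exact without any sector-convexity licence. Everything is PROVED; no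
definition, no named fact.

## Mathlib / tree search

REUSED: `energyDensityTT'_le_torus_of_lt` (HubbardNNNHoppingEnergyDensityTilingAnyParity),
`isMinOn_sub_mul_of_mem_Icc_chemPot` (HubbardFillingBoxChemicalPotentialCell),
`groundEnergy_hubbardTorusTT'_le_add_pairs` (HubbardNNNHoppingRemovalCost), `numberProj`,
`sum_numberProj_mulVec`, `dotProduct_numberProj_mulVec`, `sum_range_smul_numberProj_eq_totalNumber`
(HubbardStateSectorDecomposition / ProjectedBCSState / FermionicPEPS), `groundEnergy_le_re_expect`,
`dotProduct_eq_zero_of_isNParticle_ne`, `LiebTwo.isNParticle_mulVec_of_commute`. `lean search 'gcFloor'`,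
`'groundEnergy .* - μ'`: no grand-canonical floor of this form in the tree.

## References

* D. Ruelle, *Statistical Mechanics: Rigorous Results* (Benjamin, 1969), §3.3–§3.4 (the energy density as an
  infimum over boxes; equivalence of the canonical and grand-canonical variational problems). [Ruelle1969]
* E. H. Lieb, F. Y. Wu, Physica A 321 (2003) 1, §7 (chemical potentials as one-sided derivatives). [LiebWuPhysicaA2003]
-/

noncomputable section

namespace Literature.MathematicalPhysics.QuantumLattice

namespace ThermodynamicLimit

open Matrix Complex Finset Set HubbardWave0 Literature.Probability.LatticeModels
open scoped ComplexOrder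

/-! ### §1 Sector form -/

/-- **Grand-canonical floor, sector form (`M < 2L²`).** For `U ≥ 0`, `0 < n < 2`,
`μ ∈ [μ₋(n), μ₊(n)]`, `L ≥ 1` and every particle number `M < 2L²`:
`(e(n) − μn)·L² − (16|t| + 32|t'|)·L ≤ E_L(M) − μ·M`. The limit is an infimum
(`energyDensityTT'_le_torus_of_lt`) and `n` minimises `x ↦ e(x) − μx` (`isMinOn_sub_mul_of_mem_Icc_chemPot`).
[cite: Ruelle1969, §3.3–§3.4] -/
theorem sub_mul_sq_le_groundEnergy_sub_mul_of_lt (t t' : ℝ) {U : ℝ} (hU : 0 ≤ U) {n μ : ℝ}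
    (hn0 : 0 < n) (hn2 : n < 2) (hμ : μ ∈ Icc (chemPotMinusTT' t t' U n) (chemPotPlusTT' t t' U n))
    {L : ℕ} (hL : 1 ≤ L) {M : ℕ} (hM : M < 2 * (L * L)) :
    (energyDensityTT' t t' U n - μ * n) * (L : ℝ) ^ 2 - (16 * |t| + 32 * |t'|) * L ≤
      groundEnergy (hubbardTorusTT' L t t' U) M - μ * M := by
  have hL0 : (0 : ℝ) < L := by exact_mod_cast hL
  have hL2 : (0 : ℝ) < (L : ℝ) ^ 2 := by positivity
  have htile := energyDensityTT'_le_torus_of_lt t t' hU hL hM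
  have hx : (M : ℝ) / (L : ℝ) ^ 2 ∈ Ico (0 : ℝ) 2 := by
    refine ⟨by positivity, ?_⟩
    rw [div_lt_iff₀ hL2]
    have h : (M : ℝ) < ((2 * (L * L) : ℕ) : ℝ) := by exact_mod_cast hM
    push_cast at h
    nlinarith [h]
  have hmin : energyDensityTT' t t' U n - μ * n ≤
      energyDensityTT' t t' U ((M : ℝ) / (L : ℝ) ^ 2) - μ * ((M : ℝ) / (L : ℝ) ^ 2) :=
    isMinOn_sub_mul_of_mem_Icc_chemPot t t' hU hn0 hn2 hμ hx
  have h1 := mul_le_mul_of_nonneg_right hmin hL2.le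
  have h2 := mul_le_mul_of_nonneg_right htile hL2.le
  have e1 : (groundEnergy (hubbardTorusTT' L t t' U) M / (L : ℝ) ^ 2 + (16 * |t| + 32 * |t'|) / L) *
      (L : ℝ) ^ 2 = groundEnergy (hubbardTorusTT' L t t' U) M + (16 * |t| + 32 * |t'|) * L := by
    field_simp
  have e2 : (energyDensityTT' t t' U ((M : ℝ) / (L : ℝ) ^ 2) - μ * ((M : ℝ) / (L : ℝ) ^ 2)) * (L : ℝ) ^ 2 =
      energyDensityTT' t t' U ((M : ℝ) / (L : ℝ) ^ 2) * (L : ℝ) ^ 2 - μ * M := by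
    field_simp
  rw [e1] at h2
  rw [e2] at h1
  linarith

/-- The filled band costs at most `4·18(2|t| + |U| + 2|t'|)` more than the sector two particles below it:
`E_L(2L² − 2) ≤ E_L(2L²) + 4·18(2|t| + |U| + 2|t'|)` for `L ≥ 1` (pair-removal cost,
`groundEnergy_hubbardTorusTT'_le_add_pairs` with one pair). [cite: Ruelle1969, §3.3–§3.4] -/
theorem groundEnergy_full_sub_two_le (L : ℕ) (hL : 1 ≤ L) (t t' U : ℝ) :
    groundEnergy (hubbardTorusTT' L t t' U) (2 * (L * L) - 2) ≤
      groundEnergy (hubbardTorusTT' L t t' U) (2 * (L * L)) + 4 * (18 * (2 * |t| + |U| + 2 * |t'|)) := by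
  have hLL : 1 ≤ L * L := Nat.mul_le_mul hL hL
  have hfit : (2 * (L * L) - 2) + 2 * 1 ≤ 2 * L ^ 2 := by rw [sq]; omega
  have h := groundEnergy_hubbardTorusTT'_le_add_pairs L t t' U (N := 2 * (L * L) - 2) (m := 1) hfit
  have e : 2 * (L * L) - 2 + 2 * 1 = 2 * (L * L) := by omega
  rw [e] at h
  set K18 : ℝ := 18 * (2 * |t| + |U| + 2 * |t'|) with hK18
  have hK18 : 0 ≤ K18 := by positivity
  -- the per-pair cost `2·K18·2L²/(N+1)` with `N + 1 = 2L² − 1 ≥ L²` is at most `4 K18`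
  have hN1 : (L : ℝ) ^ 2 ≤ ((2 * (L * L) - 2 : ℕ) : ℝ) + 1 := by
    have h2 : 2 ≤ 2 * (L * L) := by omega
    rw [Nat.cast_sub h2]
    push_cast
    have : (1 : ℝ) ≤ (L : ℝ) * L := by exact_mod_cast hLL
    nlinarith [this]
  have hL2 : (0 : ℝ) < (L : ℝ) ^ 2 := by
    have : (0 : ℝ) < L := by exact_mod_cast hL
    positivity
  have hcost : (1 : ℕ) * (2 * (K18 * (2 * (L : ℝ) ^ 2) / (((2 * (L * L) - 2 : ℕ) : ℝ) + 1))) ≤ 4 * K18 := by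
    rw [Nat.cast_one, one_mul]
    have hden : (0 : ℝ) < ((2 * (L * L) - 2 : ℕ) : ℝ) + 1 := lt_of_lt_of_le hL2 hN1
    have h1 : K18 * (2 * (L : ℝ) ^ 2) / (((2 * (L * L) - 2 : ℕ) : ℝ) + 1) ≤ 2 * K18 := by
      rw [div_le_iff₀ hden]
      nlinarith [hN1, hK18]
    linarith
  exact h.trans (by linarith [hcost])

/-- **Grand-canonical floor, every sector.** For `U ≥ 0`, `0 < n < 2`, `μ ∈ [μ₋(n), μ₊(n)]`, `L ≥ 1` and
every `M ≤ 2L²`: `(e(n) − μn)L² − (16|t| + 32|t'|)L − (4·18(2|t| + |U| + 2|t'|) + 2|μ|) ≤ E_L(M) − μM`.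
[cite: Ruelle1969, §3.3–§3.4] -/
theorem sub_mul_sq_le_groundEnergy_sub_mul (t t' : ℝ) {U : ℝ} (hU : 0 ≤ U) {n μ : ℝ}
    (hn0 : 0 < n) (hn2 : n < 2) (hμ : μ ∈ Icc (chemPotMinusTT' t t' U n) (chemPotPlusTT' t t' U n))
    {L : ℕ} (hL : 1 ≤ L) {M : ℕ} (hM : M ≤ 2 * (L * L)) :
    (energyDensityTT' t t' U n - μ * n) * (L : ℝ) ^ 2 - (16 * |t| + 32 * |t'|) * L -
        (4 * (18 * (2 * |t| + |U| + 2 * |t'|)) + 2 * |μ|) ≤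
      groundEnergy (hubbardTorusTT' L t t' U) M - μ * M := by
  have hK : 0 ≤ 4 * (18 * (2 * |t| + |U| + 2 * |t'|)) := by positivity
  have hμabs : 0 ≤ 2 * |μ| := by positivity
  rcases hM.lt_or_eq with hlt | heq
  · have h := sub_mul_sq_le_groundEnergy_sub_mul_of_lt t t' hU hn0 hn2 hμ hL hlt
    linarith
  · -- the filled band
    subst heq
    have hLL : 1 ≤ L * L := Nat.mul_le_mul hL hL
    have hlt : 2 * (L * L) - 2 < 2 * (L * L) := by omega
    have h := sub_mul_sq_le_groundEnergy_sub_mul_of_lt t t' hU hn0 hn2 hμ hL hlt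
    have hfull := groundEnergy_full_sub_two_le L hL t t' U
    have hcast : ((2 * (L * L) - 2 : ℕ) : ℝ) = ((2 * (L * L) : ℕ) : ℝ) - 2 := by
      have h2 : 2 ≤ 2 * (L * L) := by omega
      rw [Nat.cast_sub h2]; push_cast; ring
    rw [hcast] at h
    have hμ2 : -(μ * 2) ≤ 2 * |μ| := by
      have := neg_abs_le μ
      linarith [le_abs_self μ]
    nlinarith [h, hfull, hμ2, le_abs_self μ, neg_abs_le μ]

/-! ### §2 Fock form -/

/-- The orbital count of the torus: `|Orb (FermionTorus 2 L)| = 2L²`. [folklore] -/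
private theorem card_orb_fermionTorus_two_eq (L : ℕ) : Fintype.card (Orb (FermionTorus 2 L)) = 2 * (L * L) := by
  rw [card_orb]
  simp [FermionTorus, Fintype.card_lex, sq]

/-- The Rayleigh bound without normalisation, for any operator: for an `M`-particle vector `φ`,
`E(M)·Re⟨φ, φ⟩ ≤ Re⟨φ, H φ⟩` (`E(M) = groundEnergy H M`, the sector infimum). [cite: Ruelle1969, §3.3–§3.4] -/
theorem groundEnergy_mul_re_dotProduct_le {κ : Type*} [LinearOrder κ] [Fintype κ]
    (H : Matrix (Finset κ) (Finset κ) ℂ) {M : ℕ} {φ : Fock κ} (hφ : IsNParticle M φ) :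
    groundEnergy H M * (star φ ⬝ᵥ φ).re ≤ (star φ ⬝ᵥ (H *ᵥ φ)).re := by
  by_cases h0 : φ = 0
  · subst h0; simp
  obtain ⟨c, hc0, hc1⟩ := exists_smul_unit h0
  have hN : IsNParticle M (c • φ) := fun s hs => by rw [Pi.smul_apply, hφ s hs, smul_zero]
  have hE := groundEnergy_le_re_expect H hN hc1
  have hcc : star c * c = ((‖c‖ ^ 2 : ℝ) : ℂ) := by
    rw [Complex.star_def, Complex.conj_mul', Complex.ofReal_pow]
  have hexp : expect H (c • φ) = ((‖c‖ ^ 2 : ℝ) : ℂ) * (star φ ⬝ᵥ (H *ᵥ φ)) := by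
    rw [expect, star_smul, mulVec_smul, smul_dotProduct, dotProduct_smul, smul_smul, hcc, smul_eq_mul]
  have hnorm : ((‖c‖ ^ 2 : ℝ) : ℂ) * (star φ ⬝ᵥ φ) = 1 := by
    rw [← hc1, star_smul, smul_dotProduct, dotProduct_smul, smul_smul, hcc, smul_eq_mul]
  have hnorm' : ‖c‖ ^ 2 * (star φ ⬝ᵥ φ).re = 1 := by
    have := congrArg Complex.re hnorm
    rwa [Complex.re_ofReal_mul, Complex.one_re] at this
  rw [hexp, Complex.re_ofReal_mul] at hE
  have hpos : 0 ≤ (star φ ⬝ᵥ φ).re := (Complex.nonneg_iff.1 (dotProduct_star_self_nonneg φ)).1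
  calc groundEnergy H M * (star φ ⬝ᵥ φ).re
      ≤ (‖c‖ ^ 2 * (star φ ⬝ᵥ (H *ᵥ φ)).re) * (star φ ⬝ᵥ φ).re :=
        mul_le_mul_of_nonneg_right hE hpos
    _ = (star φ ⬝ᵥ (H *ᵥ φ)).re * (‖c‖ ^ 2 * (star φ ⬝ᵥ φ).re) := by ring
    _ = _ := by rw [hnorm', mul_one]

/-- **A uniform sector bound is a Fock-space bound for `H − μN̂`.** If `H` conserves the particle number and
`m₀ ≤ E(M) − μM` for every sector `M ≤ |Orb Λ|`, then `m₀ ≤ Re⟨χ, (H − μN̂)χ⟩` for every unit vector `χ`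
of the Fock space (number-sector decomposition `χ = Σ_M P_M χ`). [cite: Ruelle1969, §3.3–§3.4] -/
theorem le_re_expect_sub_mul_totalNumber_of_forall_sector {Λ : Type*} [LinearOrder Λ] [Fintype Λ]
    {H : Matrix (Finset (Orb Λ)) (Finset (Orb Λ)) ℂ} (hHN : Commute H totalNumber) {μ m₀ : ℝ}
    (hsec : ∀ M : ℕ, M ≤ Fintype.card (Orb Λ) → m₀ ≤ groundEnergy H M - μ * M)
    (χ : Fock (Orb Λ)) (hχ : star χ ⬝ᵥ χ = 1) :
    m₀ ≤ (star χ ⬝ᵥ ((H - (μ : ℂ) • totalNumber) *ᵥ χ)).re := by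
  classical
  set R := range (Fintype.card (Orb Λ) + 1) with hR
  -- decompose `χ` into sectors
  have hdecomp : star χ ⬝ᵥ (H *ᵥ χ) = ∑ M ∈ R, star (numberProj M *ᵥ χ) ⬝ᵥ (H *ᵥ (numberProj M *ᵥ χ)) := by
    conv_lhs => rw [← sum_numberProj_mulVec χ]
    rw [star_sum, sum_dotProduct, mulVec_sum]
    refine Finset.sum_congr rfl fun M _ => ?_
    rw [dotProduct_sum]
    refine Finset.sum_eq_single M (fun M' _ hMN => ?_) (fun h => absurd (by assumption) h)
    exact dotProduct_eq_zero_of_isNParticle_ne (isNParticle_numberProj_mulVec M χ)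
      (LiebTwo.isNParticle_mulVec_of_commute (isNParticle_numberProj_mulVec M' χ) hHN.symm.eq) (Ne.symm hMN)
  have hnum : star χ ⬝ᵥ (((μ : ℂ) • totalNumber) *ᵥ χ) =
      ∑ M ∈ R, (μ : ℂ) * (M : ℂ) * (star (numberProj M *ᵥ χ) ⬝ᵥ (numberProj M *ᵥ χ)) := by
    rw [← sum_range_smul_numberProj_eq_totalNumber, Finset.smul_sum, Matrix.sum_mulVec, dotProduct_sum]
    refine Finset.sum_congr rfl fun M _ => ?_
    rw [smul_smul, smul_mulVec, dotProduct_smul, smul_eq_mul, dotProduct_numberProj_mulVec]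
  have hone : ∑ M ∈ R, (star (numberProj M *ᵥ χ) ⬝ᵥ (numberProj M *ᵥ χ)).re = 1 := by
    have h1 : star χ ⬝ᵥ ((∑ M ∈ R, (numberProj M : Matrix (Finset (Orb Λ)) (Finset (Orb Λ)) ℂ)) *ᵥ χ) = 1 := by
      rw [hR, sum_range_numberProj, one_mulVec, hχ]
    rw [Matrix.sum_mulVec, dotProduct_sum] at h1
    have h2 := congrArg Complex.re h1
    rw [Complex.re_sum, Complex.one_re] at h2
    rw [← h2]
    refine Finset.sum_congr rfl fun M _ => ?_
    rw [dotProduct_numberProj_mulVec]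
  -- sector by sector
  have hsecM : ∀ M ∈ R, m₀ * (star (numberProj M *ᵥ χ) ⬝ᵥ (numberProj M *ᵥ χ)).re ≤
      (star (numberProj M *ᵥ χ) ⬝ᵥ (H *ᵥ (numberProj M *ᵥ χ))).re -
        ((μ : ℂ) * (M : ℂ) * (star (numberProj M *ᵥ χ) ⬝ᵥ (numberProj M *ᵥ χ))).re := by
    intro M hM
    have hMle : M ≤ Fintype.card (Orb Λ) := Nat.lt_succ_iff.1 (mem_range.1 hM)
    have hray := groundEnergy_mul_re_dotProduct_le H (isNParticle_numberProj_mulVec M χ)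
    have hpos : 0 ≤ (star (numberProj M *ᵥ χ) ⬝ᵥ (numberProj M *ᵥ χ)).re :=
      (Complex.nonneg_iff.1 (dotProduct_star_self_nonneg _)).1
    have e : ((μ : ℂ) * (M : ℂ) * (star (numberProj M *ᵥ χ) ⬝ᵥ (numberProj M *ᵥ χ))).re =
        μ * M * (star (numberProj M *ᵥ χ) ⬝ᵥ (numberProj M *ᵥ χ)).re := by
      rw [show (μ : ℂ) * (M : ℂ) = ((μ * M : ℝ) : ℂ) by push_cast; ring, Complex.re_ofReal_mul]
    rw [e]
    nlinarith [hsec M hMle, hray, hpos]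
  rw [sub_mulVec, dotProduct_sub, Complex.sub_re, hdecomp, hnum, Complex.re_sum, Complex.re_sum,
    ← Finset.sum_sub_distrib]
  calc m₀ = m₀ * 1 := (mul_one _).symm
    _ = ∑ M ∈ R, m₀ * (star (numberProj M *ᵥ χ) ⬝ᵥ (numberProj M *ᵥ χ)).re := by
        rw [← hone, Finset.mul_sum]
    _ ≤ _ := Finset.sum_le_sum hsecM

/-- **Grand-canonical floor, Fock form.** For `U ≥ 0`, `0 < n < 2`, `μ ∈ [μ₋(n), μ₊(n)]`, `L ≥ 1` and
EVERY unit vector `χ` of the Fock space of the torus: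
`(e(n) − μn)L² − (16|t| + 32|t'|)L − (4·18(2|t| + |U| + 2|t'|) + 2|μ|) ≤ Re⟨χ, (H_L − μN̂)χ⟩` — the global
`K_μ`-floor at a supporting slope, with an explicit `O(L)` rate. [cite: Ruelle1969, §3.3–§3.4] -/
theorem sub_mul_sq_le_re_expect_sub_mul_totalNumber (t t' : ℝ) {U : ℝ} (hU : 0 ≤ U) {n μ : ℝ}
    (hn0 : 0 < n) (hn2 : n < 2) (hμ : μ ∈ Icc (chemPotMinusTT' t t' U n) (chemPotPlusTT' t t' U n))
    {L : ℕ} (hL : 1 ≤ L) (χ : Fock (Orb (FermionTorus 2 L))) (hχ : star χ ⬝ᵥ χ = 1) :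
    (energyDensityTT' t t' U n - μ * n) * (L : ℝ) ^ 2 - (16 * |t| + 32 * |t'|) * L -
        (4 * (18 * (2 * |t| + |U| + 2 * |t'|)) + 2 * |μ|) ≤
      (star χ ⬝ᵥ ((hubbardTorusTT' L t t' U - (μ : ℂ) • totalNumber) *ᵥ χ)).re := by
  refine le_re_expect_sub_mul_totalNumber_of_forall_sector (hubbardTorusTT'_commute_totalNumber L t t' U)
    (fun M hM => ?_) χ hχ
  rw [card_orb_fermionTorus_two_eq] at hM
  exact sub_mul_sq_le_groundEnergy_sub_mul t t' hU hn0 hn2 hμ hL hM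

end ThermodynamicLimit

end Literature.MathematicalPhysics.QuantumLattice

end
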